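import Summits.BirchSwinnertonDyer.Rank2.Chi8FloorTwistDoorProved
import HarnessLib

/-!
# The χ₈-floor kernel, Part F of 8 — §TwistDoorStreamlined, §ForcedZerosAnalytic, §PeriodFree

Planner p2 GEN 40–42 kernel `Chi8Floor` v10 (cell bsd-rank2, HOME/p2/g43/lean/Chi8Floor_v10.lean, sha bc257584; 60 theorems, `lean check` rc 0 / 0 sorry),
split into ≤400-line tree files `Rank2/Chi8Floor{Certificate,ConductorLevel,TwistDoor,LatticeEngine,TwistDoorProved,PeriodFree,TwistDoorFinal,KatoFree}`
(A–H, a linear import chain) by the lead star-p1 GEN 18 at the planner's LANDING ASK.  The mathematical overview, the honest framing (Barrier B1: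
`ord_{T=0} L₂` is the 2-adic analytic order, never `r_an`; BSD is not proved) and the references are in Part A's module docstring
(`Rank2/Chi8FloorCertificate.lean`); every theorem below carries its own `[cite: …]` tags.  Theorems only; no definition, no named fact, no instance.
[cite: MazurTateTeitelbaum1986Invent, §I.14 Proposition (p. 20)] [cite: Kato2004Asterisque, Thm. 18.4 (p. 281)] [cite: GreenbergLNM1716, §5 (p. 181)]
[cite: Stevens1989, Lemma (5.4)]
-/

noncomputable section

open PowerSeries WeierstrassCurve CongruenceSubgroup Filter
open Literature.NumberTheory.EllipticCurves Literature.NumberTheory.EllipticCurves.ModularForms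
open Literature.Barriers.BirchSwinnertonDyer

namespace Summit.BirchSwinnertonDyer.Rank2

section TwistDoorStreamlined

/-! ### The proved door, streamlined

`rank_eq_two_of_twistedEighth_forcedZeros` with `ε`, the real Gauss sum and `[q/8]⁺` discharged:
the inputs left are the period-unit ratio, `a_q(f₀)` odd, `[1/8]⁺_{f₀}` a `2`-adic unit, `L(f₀,1) = 0`,
the four forced zeros (as twisted symbol-sum vanishings), the non-rectangular lattice, Kato at `2`
and planted rank. -/

variable {N₀ : ℕ} [NeZero N₀] {q : ℕ} [NeZero q] (L : ℕ) [NeZero L]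
variable {W : WeierstrassCurve ℚ} [W.IsElliptic] [W.IsGloballyMinimal]

/-- **THE PROVED DOOR, streamlined** (`E = E₀^{(q)}`, `N₀` odd, `q ≡ 1 (mod 4)` an odd prime with
`a_q(E₀)` odd, regime of forced zeros and rhombic `Λ_{f₀}`): Kato at `2` + `rank E(ℚ) ≥ 2` ⇒
`rank = corank Sel_{2^∞} = ord_{T=0} L₂(E,T) = 2`, `corank Ш(E)[2^∞] = 0`.
[cite: Kato2004Asterisque, Thm. 18.4 (p. 281)] [cite: MazurTateTeitelbaum1986Invent, §I.8 and §I.14] -/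
theorem rank_eq_two_of_twistedEighth_forcedZeros' (hN : N₀ ∣ L) (hm : q ^ 2 ∣ L)
    {χ : DirichletCharacter ℂ q} (hχ : χ.IsQuadratic) (hχe : χ.Even) (hχp : χ.IsPrimitive)
    {f₀ : CuspForm (Gamma0 N₀) 2} (hf₀ : IsNewform0 f₀) (hQ₀ : coeffField f₀ = ⊥) (hN2 : ¬ 2 ∣ N₀)
    (hL2 : ¬ 2 ∣ L) (hord : IsOrdinaryAt W 2) (hF : IsNewformOf W (charTwist L hN hm hχ f₀))
    (hper : ∃ u : ℚ, ‖(u : ℚ_[2])‖ = 1 ∧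
      (u : ℂ) * (plusPeriod (charTwist L hN hm hχ f₀) : ℂ) * gaussSum χ (ZMod.stdAddChar (N := q)) =
        (plusPeriod f₀ : ℂ))
    (hq : q.Prime) (hq2 : q ≠ 2) (hqN : ¬ q ∣ N₀) {a : ℤ} (ha : cuspCoeff f₀ q = a) (hodd : Odd a)
    {a₂ : ℤ} (ha₂ : cuspCoeff f₀ 2 = a₂)
    (h18 : ‖((ratPlusSymbol f₀ (1 / 8) : ℚ) : ℚ_[2])‖ = 1)
    (hL0 : modularSymbol f₀ 0 = 0)
    (h4 : modularSymbol f₀ (1 / 4) - modularSymbol f₀ (3 / 4) = 0)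
    (h8m : modularSymbol f₀ (1 / 8) + modularSymbol f₀ (3 / 8) - modularSymbol f₀ (5 / 8)
      - modularSymbol f₀ (7 / 8) = 0)
    (h4F : modularSymbol (charTwist L hN hm hχ f₀) (1 / 4) - modularSymbol (charTwist L hN hm hχ f₀) (3 / 4) = 0)
    (h8F : modularSymbol (charTwist L hN hm hχ f₀) (1 / 8) + modularSymbol (charTwist L hN hm hχ f₀) (3 / 8)
      - modularSymbol (charTwist L hN hm hχ f₀) (5 / 8) - modularSymbol (charTwist L hN hm hχ f₀) (7 / 8) = 0)
    (hΛ : ∀ z ∈ periodLattice f₀, z.im = 0 → ∃ k : ℤ, z = k * (plusPeriod f₀ : ℂ))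
    (hKato : kato_selmerCorank_le_order_padicLFunction_allPrimes W 2 (f := charTwist L hN hm hχ f₀))
    (hrank : 2 ≤ W.mordellWeilRank) :
    W.mordellWeilRank = 2 ∧ W.selmerCorank 2 = 2 ∧ W.shaCorank 2 = 0 ∧
      (padicLFunction (charTwist L hN hm hχ f₀) (unitRoot W 2 : ℚ_[2])).order = (2 : ℕ) := by
  obtain ⟨ε, hε, hε0, hεodd⟩ := exists_int_eq_of_isQuadratic hχ hq
  have hg := im_gaussSum_eq_zero_of_isQuadratic_of_even hχ hχp hχe hq
  have h0 := ratPlusSymbol_zero_eq_zero_of_modularSymbol hf₀ hQ₀ hL0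
  have h8q : ‖((ratPlusSymbol f₀ ((q : ℚ) / 8) : ℚ) : ℚ_[2])‖ = 1 := by
    rw [norm_ratPlusSymbol_div_eight_eq hf₀ hQ₀ hN2 ha₂ h0 (hq.odd_of_ne_two hq2), h18]
  exact rank_eq_two_of_twistedEighth_forcedZeros L hN hm hχ hχe hχp hf₀ hQ₀ hN2 hL2 hord hF ε hε hε0
    hεodd hper hq hq2 hqN ha hodd h8q h18.le hL0 h4 h8m h4F h8F hg hΛ hKato hrank

/-- **Unconditional analytic half, streamlined**: `L(E,1) = 0 ⇒ ord_{T=0} L₂(E,T) ≤ 2` for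
`E = E₀^{(q)}` in the same regime (no Kato, no points). [cite: MazurTateTeitelbaum1986Invent, §I.8 and §I.14] -/
theorem order_padicLFunction_le_two_of_twistedEighth_forcedZeros' (hN : N₀ ∣ L) (hm : q ^ 2 ∣ L)
    {χ : DirichletCharacter ℂ q} (hχ : χ.IsQuadratic) (hχe : χ.Even) (hχp : χ.IsPrimitive)
    {f₀ : CuspForm (Gamma0 N₀) 2} (hf₀ : IsNewform0 f₀) (hQ₀ : coeffField f₀ = ⊥) (hN2 : ¬ 2 ∣ N₀)
    (hL2 : ¬ 2 ∣ L) (hord : IsOrdinaryAt W 2) (hF : IsNewformOf W (charTwist L hN hm hχ f₀))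
    (hL : W.entireLFunction 1 = 0)
    (hper : ∃ u : ℚ, ‖(u : ℚ_[2])‖ = 1 ∧
      (u : ℂ) * (plusPeriod (charTwist L hN hm hχ f₀) : ℂ) * gaussSum χ (ZMod.stdAddChar (N := q)) =
        (plusPeriod f₀ : ℂ))
    (hq : q.Prime) (hq2 : q ≠ 2) (hqN : ¬ q ∣ N₀) {a : ℤ} (ha : cuspCoeff f₀ q = a) (hodd : Odd a)
    {a₂ : ℤ} (ha₂ : cuspCoeff f₀ 2 = a₂)
    (h18 : ‖((ratPlusSymbol f₀ (1 / 8) : ℚ) : ℚ_[2])‖ = 1)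
    (hL0 : modularSymbol f₀ 0 = 0)
    (h4 : modularSymbol f₀ (1 / 4) - modularSymbol f₀ (3 / 4) = 0)
    (h8m : modularSymbol f₀ (1 / 8) + modularSymbol f₀ (3 / 8) - modularSymbol f₀ (5 / 8)
      - modularSymbol f₀ (7 / 8) = 0)
    (h4F : modularSymbol (charTwist L hN hm hχ f₀) (1 / 4) - modularSymbol (charTwist L hN hm hχ f₀) (3 / 4) = 0)
    (h8F : modularSymbol (charTwist L hN hm hχ f₀) (1 / 8) + modularSymbol (charTwist L hN hm hχ f₀) (3 / 8)
      - modularSymbol (charTwist L hN hm hχ f₀) (5 / 8) - modularSymbol (charTwist L hN hm hχ f₀) (7 / 8) = 0)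
    (hΛ : ∀ z ∈ periodLattice f₀, z.im = 0 → ∃ k : ℤ, z = k * (plusPeriod f₀ : ℂ)) :
    (padicLFunction (charTwist L hN hm hχ f₀) (unitRoot W 2 : ℚ_[2])).order ≤ (2 : ℕ) := by
  obtain ⟨ε, hε, hε0, hεodd⟩ := exists_int_eq_of_isQuadratic hχ hq
  have hg := im_gaussSum_eq_zero_of_isQuadratic_of_even hχ hχp hχe hq
  have h0 := ratPlusSymbol_zero_eq_zero_of_modularSymbol hf₀ hQ₀ hL0
  have h8q : ‖((ratPlusSymbol f₀ ((q : ℚ) / 8) : ℚ) : ℚ_[2])‖ = 1 := by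
    rw [norm_ratPlusSymbol_div_eight_eq hf₀ hQ₀ hN2 ha₂ h0 (hq.odd_of_ne_two hq2), h18]
  exact order_padicLFunction_le_two_of_twistedEighth_forcedZeros L hN hm hχ hχe hχp hf₀ hQ₀ hN2 hL2
    hord hF hL ε hε hε0 hεodd hper hq hq2 hqN ha hodd h8q h18.le hL0 h4 h8m h4F h8F hg hΛ

end TwistDoorStreamlined

section ForcedZerosAnalytic

/-! ### The forced zeros as central `L`-values (Birch's formula)

The four symbol-sum hypotheses of the door (`h4`, `h8m`, `h4F`, `h8F`) are the vanishing of the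
twisted symbol sums `∑ χ(a){∞, a/m}` for `χ = χ₋₄` (mod `4`) and `χ = χ₋₈ = χ₈'` (mod `8`). By Birch's
formula (`twisted_LValue_eq_holds`, proved in the tree for primitive `χ` and ANY entire continuation of
`L(f, χ, s)`) each is implied by the central vanishing `L(f, χ, 1) = 0`, i.e. by `L(E^{(−1)}, 1) = 0`,
`L(E^{(−2)}, 1) = 0` for `E ∈ {E₀, E₀^{(q)}}` — forced by the signs `w(E₀^{(D)}) = χ_D(−N₀) w(E₀) = −1`
(`D = −4, −8, −4q, −8q`; `N₀ ≡ 1 (8)`, `q ≡ 1 (4)`). -/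

variable {N : ℕ} [NeZero N]

/-- `L(f, χ₋₄, 1) = 0` ⇒ `{∞, 1/4}_f − {∞, 3/4}_f = 0` (Birch's formula at the primitive quadratic
character mod `4`). [cite: MazurTateTeitelbaum1986Invent, §I.8 (8.6)] [cite: Birch1971] -/
theorem modularSymbol_quarters_eq_zero_of_twistedLValue_χ₄ (f : CuspForm (Gamma0 N) 2)
    (hZ : ∃ L : ℂ → ℂ, Differentiable ℂ L ∧
      (∀ s : ℂ, 2 < s.re → L s = twistedLSeries f (ZMod.χ₄.ringHomComp (Int.castRingHom ℂ)) s) ∧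
      L 1 = 0) :
    modularSymbol f (1 / 4) - modularSymbol f (3 / 4) = 0 := by
  obtain ⟨L, hLd, hLs, hL1⟩ := hZ
  have hB := twisted_LValue_eq_holds f (m := 4) isPrimitive_χ₄_ringHomComp hLd hLs
  rw [hL1, mul_zero, MulChar.IsQuadratic.inv isQuadratic_χ₄_ringHomComp] at hB
  have hsum : twistedSymbolSum f (ZMod.χ₄.ringHomComp (Int.castRingHom ℂ)) =
      ∑ a : Fin 4, (ZMod.χ₄.ringHomComp (Int.castRingHom ℂ)) a *
        modularSymbol f (((@ZMod.val 4 a : ℕ) : ℚ) / 4) := rfl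
  rw [hsum, Fin.sum_univ_four] at hB
  simp only [MulChar.ringHomComp_apply] at hB
  rw [show ZMod.χ₄ (0 : Fin 4) = 0 from rfl, show ZMod.χ₄ (1 : Fin 4) = 1 from rfl,
    show ZMod.χ₄ (2 : Fin 4) = 0 from rfl, show ZMod.χ₄ (3 : Fin 4) = -1 from rfl,
    show @ZMod.val 4 (1 : Fin 4) = 1 from rfl, show @ZMod.val 4 (3 : Fin 4) = 3 from rfl] at hB
  simp only [map_zero, zero_mul, map_one, one_mul, zero_add, add_zero, map_neg, neg_mul,
    Nat.cast_one, Nat.cast_ofNat] at hB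
  linear_combination (-1 : ℂ) * hB

/-- `L(f, χ₋₈, 1) = 0` ⇒ `{∞,1/8} + {∞,3/8} − {∞,5/8} − {∞,7/8} = 0` (Birch's formula at
`χ₋₈ = χ₈'`, primitive mod `8`). [cite: MazurTateTeitelbaum1986Invent, §I.8 (8.6)] [cite: Birch1971] -/
theorem modularSymbol_eighths_eq_zero_of_twistedLValue_χ₈' (f : CuspForm (Gamma0 N) 2)
    (hZ : ∃ L : ℂ → ℂ, Differentiable ℂ L ∧
      (∀ s : ℂ, 2 < s.re → L s = twistedLSeries f (ZMod.χ₈'.ringHomComp (Int.castRingHom ℂ)) s) ∧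
      L 1 = 0) :
    modularSymbol f (1 / 8) + modularSymbol f (3 / 8) - modularSymbol f (5 / 8)
      - modularSymbol f (7 / 8) = 0 := by
  obtain ⟨L, hLd, hLs, hL1⟩ := hZ
  have hB := twisted_LValue_eq_holds f (m := 8) isPrimitive_χ₈'_ringHomComp hLd hLs
  rw [hL1, mul_zero, MulChar.IsQuadratic.inv isQuadratic_χ₈'_ringHomComp] at hB
  have hsum : twistedSymbolSum f (ZMod.χ₈'.ringHomComp (Int.castRingHom ℂ)) =
      ∑ a : Fin 8, (ZMod.χ₈'.ringHomComp (Int.castRingHom ℂ)) a *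
        modularSymbol f (((@ZMod.val 8 a : ℕ) : ℚ) / 8) := rfl
  rw [hsum, Fin.sum_univ_eight] at hB
  simp only [MulChar.ringHomComp_apply] at hB
  rw [show ZMod.χ₈' (0 : Fin 8) = 0 from rfl, show ZMod.χ₈' (1 : Fin 8) = 1 from rfl,
    show ZMod.χ₈' (2 : Fin 8) = 0 from rfl, show ZMod.χ₈' (3 : Fin 8) = 1 from rfl,
    show ZMod.χ₈' (4 : Fin 8) = 0 from rfl, show ZMod.χ₈' (5 : Fin 8) = -1 from rfl,
    show ZMod.χ₈' (6 : Fin 8) = 0 from rfl, show ZMod.χ₈' (7 : Fin 8) = -1 from rfl,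
    show @ZMod.val 8 (1 : Fin 8) = 1 from rfl, show @ZMod.val 8 (3 : Fin 8) = 3 from rfl,
    show @ZMod.val 8 (5 : Fin 8) = 5 from rfl, show @ZMod.val 8 (7 : Fin 8) = 7 from rfl] at hB
  simp only [map_zero, zero_mul, map_one, one_mul, zero_add, add_zero, map_neg, neg_mul,
    Nat.cast_one, Nat.cast_ofNat] at hB
  linear_combination (-1 : ℂ) * hB

/-- `L(f, 1) = 0` (for an entire continuation of `L(f,s)`) ⇒ `{∞, 0}_f = 0`
(`modularSymbol_zero_eq_holds`). [cite: Manin1972, Thm. 1.3 proof] -/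
theorem modularSymbol_zero_eq_zero_of_LValue (f : CuspForm (Gamma0 N) 2)
    (hZ : ∃ L : ℂ → ℂ, Differentiable ℂ L ∧ (∀ s : ℂ, 2 < s.re → L s = cuspFormLSeries f s) ∧
      L 1 = 0) :
    modularSymbol f 0 = 0 := by
  obtain ⟨L, hLd, hLs, hL1⟩ := hZ
  rw [modularSymbol_zero_eq_holds f hLd hLs, hL1]

end ForcedZerosAnalytic

section PeriodFree

/-! ### The period-unit hypothesis is superfluous (Stevens' inclusion `g(χ)·Λ(f_χ) ⊆ Λ(f)`)

The one-constant twisting formula gives `[r]⁺_{f_χ} = c · ∑_u ε(u)[r + u/q]⁺_f` with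
`c · Ω⁺_{f_χ} · g(χ) = Ω⁺_f`. Stevens' lattice inclusion `g(χ) · Λ(f_χ) ⊆ Λ(f)` (tree:
`gaussSum_mul_mem_periodLattice_of_mem_charTwist`, proved) and `g(χ) ∈ ℝ` give
`g(χ) Ω⁺_{f_χ} = k Ω⁺_f` with `k ∈ ℤ`, so `c = 1/k` and `‖c‖₂ ≥ 1`: the `2`-adic size of `[1/8]⁺_{f_χ}`
is AT LEAST that of the twisted eighth sum — which is all the χ₈-floor needs. So the door needs no
period relation à la Mazur–Tate–Teitelbaum §I.8 / Pal. -/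

variable {N₀ : ℕ} [NeZero N₀] {q : ℕ} [NeZero q] (L : ℕ) [NeZero L]

/-- **`‖c‖₂ ≥ 1` for the twisting constant**, from Stevens' inclusion `g(χ)Λ(f_χ) ⊆ Λ(f)`.
[cite: Stevens1989, Lemma (5.4), proof p. 97] [cite: MazurTateTeitelbaum1986Invent, §I.8] -/
theorem one_le_norm_twistConstant (hN : N₀ ∣ L) (hm : q ^ 2 ∣ L)
    {χ : DirichletCharacter ℂ q} (hχ : χ.IsQuadratic) (hχp : χ.IsPrimitive)
    {f₀ : CuspForm (Gamma0 N₀) 2} (hf₀ : IsNewform0 f₀) (hQ₀ : coeffField f₀ = ⊥)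
    (hF : IsNewform0 (charTwist L hN hm hχ f₀)) (hQF : coeffField (charTwist L hN hm hχ f₀) = ⊥)
    (hg : (gaussSum χ (ZMod.stdAddChar (N := q))).im = 0) {c : ℚ}
    (hc : (c : ℂ) * (plusPeriod (charTwist L hN hm hχ f₀) : ℂ) * gaussSum χ (ZMod.stdAddChar (N := q)) =
      (plusPeriod f₀ : ℂ)) :
    1 ≤ ‖(c : ℚ_[2])‖ := by
  set F := charTwist L hN hm hχ f₀ with hFdef
  set g : ℂ := gaussSum χ (ZMod.stdAddChar (N := q)) with hgdef
  have hΩF : 0 < plusPeriod F := IsNewform0.plusPeriod_pos_holds hF hQF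
  have hΩ₀ : 0 < plusPeriod f₀ := IsNewform0.plusPeriod_pos_holds hf₀ hQ₀
  obtain ⟨hreF, -⟩ := realPeriods_eq_zmultiples_of_plusPeriod_ne_zero F hΩF.ne'
  obtain ⟨hre₀, -⟩ := realPeriods_eq_zmultiples_of_plusPeriod_ne_zero f₀ hΩ₀.ne'
  -- a period `z ∈ Λ(F)` with `re z = Ω⁺_F/2`
  have hmem : plusPeriod F / 2 ∈ realPeriods F := by
    rw [hreF]; exact AddSubgroup.mem_zmultiples _
  obtain ⟨z, hz, hzre⟩ := AddSubgroup.mem_map.mp hmem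
  -- `g z ∈ Λ(f₀)`, so `re (g z) = g.re · Ω⁺_F/2 ∈ ℤ · Ω⁺_{f₀}/2`
  have hgz : g * z ∈ periodLattice f₀ :=
    gaussSum_mul_mem_periodLattice_of_mem_charTwist L hN hm hχ hχp f₀ hz
  have hgzre : (g * z).re ∈ realPeriods f₀ := AddSubgroup.mem_map_of_mem _ hgz
  rw [hre₀, AddSubgroup.mem_zmultiples_iff] at hgzre
  obtain ⟨k, hk⟩ := hgzre
  have hzre' : z.re = plusPeriod F / 2 := by simpa using hzre
  rw [Complex.mul_re, hg, zero_mul, sub_zero, hzre', zsmul_eq_mul] at hk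
  -- `hk : k * (Ω₀/2) = g.re * (Ω_F/2)`; real part of `hc`: `c * Ω_F * g.re = Ω₀`
  have hgre : g = (g.re : ℂ) := by
    apply Complex.ext <;> simp [hg]
  have hc' : (c : ℝ) * plusPeriod F * g.re = plusPeriod f₀ := by
    have := congrArg Complex.re hc
    rw [hgre] at this
    simpa [Complex.mul_re, Complex.ofReal_re, Complex.ofReal_im, Complex.ratCast_re,
      Complex.ratCast_im] using this
  have hck : (c : ℝ) * k = 1 := by
    have h1 : (c : ℝ) * (k * (plusPeriod f₀ / 2)) = plusPeriod f₀ / 2 := by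
      rw [hk]; linear_combination (1 / 2 : ℝ) * hc'
    have hΩ2 : plusPeriod f₀ / 2 ≠ 0 := by positivity
    have := mul_right_cancel₀ hΩ2 (by rw [mul_assoc, h1, one_mul] : (c : ℝ) * k * (plusPeriod f₀ / 2) = 1 * (plusPeriod f₀ / 2))
    simpa using this
  have hckQ : c * (k : ℚ) = 1 := by exact_mod_cast hck
  have hnorm : ‖(c : ℚ_[2])‖ * ‖((k : ℚ) : ℚ_[2])‖ = 1 := by
    rw [← norm_mul]; exact_mod_cast congrArg (fun x : ℚ ↦ ‖(x : ℚ_[2])‖) hckQ |>.trans (by simp)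
  have hk1 : ‖((k : ℚ) : ℚ_[2])‖ ≤ 1 := by
    simpa using Padic.norm_int_le_one (p := 2) k
  have hkpos : 0 < ‖((k : ℚ) : ℚ_[2])‖ := by
    rcases eq_or_ne (‖((k : ℚ) : ℚ_[2])‖) 0 with h0 | h0
    · rw [h0, mul_zero] at hnorm; exact absurd hnorm zero_ne_one
    · exact lt_of_le_of_ne (norm_nonneg _) h0.symm
  nlinarith [norm_nonneg (c : ℚ_[2])]

/-- **`‖[1/8]⁺_{f_χ}‖₂ ≥ 1` without any period hypothesis**: the twisted eighth sum is a `2`-adic unit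
(engine) and `‖c‖₂ ≥ 1` (`one_le_norm_twistConstant`). [cite: MazurTateTeitelbaum1986Invent, §I.8]
[cite: Stevens1989, Lemma (5.4)] -/
theorem one_le_norm_ratPlusSymbol_charTwist_eighth (hN : N₀ ∣ L) (hm : q ^ 2 ∣ L)
    {χ : DirichletCharacter ℂ q} (hχ : χ.IsQuadratic) (hχe : χ.Even) (hχp : χ.IsPrimitive)
    {f₀ : CuspForm (Gamma0 N₀) 2} (hf₀ : IsNewform0 f₀) (hQ₀ : coeffField f₀ = ⊥)
    (hF : IsNewform0 (charTwist L hN hm hχ f₀)) (hQF : coeffField (charTwist L hN hm hχ f₀) = ⊥)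
    (ε : ZMod q → ℤ) (hε : ∀ u, χ u = (ε u : ℂ))
    (hg : (gaussSum χ (ZMod.stdAddChar (N := q))).im = 0)
    (hq : q.Prime) (hq2 : q ≠ 2) (hqN : ¬ q ∣ N₀) {a : ℤ} (ha : cuspCoeff f₀ q = a) (hodd : Odd a)
    (h8q : ‖((ratPlusSymbol f₀ ((q : ℚ) / 8) : ℚ) : ℚ_[2])‖ = 1)
    (h8 : ‖((ratPlusSymbol f₀ (1 / 8) : ℚ) : ℚ_[2])‖ ≤ 1)
    (hM : ‖((∑ u : ZMod q, (1 - (ε u : ℚ)) * ratPlusSymbol f₀ (1 / 8 + twistShift u)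
            - ratPlusSymbol f₀ (1 / 8) : ℚ) : ℚ_[2])‖ ≤ 2⁻¹) :
    1 ≤ ‖((ratPlusSymbol (charTwist L hN hm hχ f₀) (1 / 8) : ℚ) : ℚ_[2])‖ := by
  obtain ⟨c, hc, hcΩ⟩ :=
    exists_rat_forall_ratPlusSymbol_charTwist_eq L hN hm hχ hχe hχp hf₀ hQ₀ hF hQF ε hε
  have hV := norm_twistedEighthSum_eq_one hf₀ hQ₀ hq hq2 hqN ha hodd ε h8q h8 hM
  have hV0 : ∑ u : ZMod q, (ε u : ℚ) * ratPlusSymbol f₀ (1 / 8 + twistShift u) ≠ 0 := by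
    intro h0
    rw [h0] at hV
    simp at hV
  have hc1 := one_le_norm_twistConstant L hN hm hχ hχp hf₀ hQ₀ hF hQF hg (hcΩ ⟨1 / 8, hV0⟩)
  have hV' := hV
  push_cast at hV'
  rw [hc (1 / 8)]
  push_cast
  rw [norm_mul, hV', mul_one]
  exact hc1

/-- **`‖[1/8]⁺_{f_χ}‖₂ ≥ 1` from the lattice engine** (forced zeros + rhombic `Λ(f₀)`), with NO period
hypothesis. [cite: MazurTateTeitelbaum1986Invent, §I.8] [cite: Stevens1989, Lemma (5.4)] [cite: Zhai2016, §3] -/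
theorem one_le_norm_ratPlusSymbol_charTwist_eighth_of_forcedZeros (hN : N₀ ∣ L) (hm : q ^ 2 ∣ L)
    {χ : DirichletCharacter ℂ q} (hχ : χ.IsQuadratic) (hχe : χ.Even) (hχp : χ.IsPrimitive)
    {f₀ : CuspForm (Gamma0 N₀) 2} (hf₀ : IsNewform0 f₀) (hQ₀ : coeffField f₀ = ⊥) (hN2 : ¬ 2 ∣ N₀)
    (hL2 : ¬ 2 ∣ L) (hF : IsNewform0 (charTwist L hN hm hχ f₀))
    (hQF : coeffField (charTwist L hN hm hχ f₀) = ⊥)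
    (hq : q.Prime) (hq2 : q ≠ 2) (hqN : ¬ q ∣ N₀) {a : ℤ} (ha : cuspCoeff f₀ q = a) (hodd : Odd a)
    {a₂ : ℤ} (ha₂ : cuspCoeff f₀ 2 = a₂)
    (h18 : ‖((ratPlusSymbol f₀ (1 / 8) : ℚ) : ℚ_[2])‖ = 1)
    (hL0 : modularSymbol f₀ 0 = 0)
    (h4 : modularSymbol f₀ (1 / 4) - modularSymbol f₀ (3 / 4) = 0)
    (h8m : modularSymbol f₀ (1 / 8) + modularSymbol f₀ (3 / 8) - modularSymbol f₀ (5 / 8)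
      - modularSymbol f₀ (7 / 8) = 0)
    (h4F : modularSymbol (charTwist L hN hm hχ f₀) (1 / 4) - modularSymbol (charTwist L hN hm hχ f₀) (3 / 4) = 0)
    (h8F : modularSymbol (charTwist L hN hm hχ f₀) (1 / 8) + modularSymbol (charTwist L hN hm hχ f₀) (3 / 8)
      - modularSymbol (charTwist L hN hm hχ f₀) (5 / 8) - modularSymbol (charTwist L hN hm hχ f₀) (7 / 8) = 0)
    (hΛ : ∀ z ∈ periodLattice f₀, z.im = 0 → ∃ k : ℤ, z = k * (plusPeriod f₀ : ℂ)) :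
    1 ≤ ‖((ratPlusSymbol (charTwist L hN hm hχ f₀) (1 / 8) : ℚ) : ℚ_[2])‖ := by
  obtain ⟨ε, hε, hε0, hεodd⟩ := exists_int_eq_of_isQuadratic hχ hq
  have hg := im_gaussSum_eq_zero_of_isQuadratic_of_even hχ hχp hχe hq
  have h0 := ratPlusSymbol_zero_eq_zero_of_modularSymbol hf₀ hQ₀ hL0
  have h8q : ‖((ratPlusSymbol f₀ ((q : ℚ) / 8) : ℚ) : ℚ_[2])‖ = 1 := by
    rw [norm_ratPlusSymbol_div_eight_eq hf₀ hQ₀ hN2 ha₂ h0 (hq.odd_of_ne_two hq2), h18]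
  have hM := norm_qnrHalfSum_le_half_of_forcedZeros L hN hm hχ hχp hf₀ hQ₀ hN2 hL2 hF hQF
    ε hε hε0 hεodd hq hq2 hqN ha hL0 h4 h8m h4F h8F hg hΛ
  exact one_le_norm_ratPlusSymbol_charTwist_eighth L hN hm hχ hχe hχp hf₀ hQ₀ hF hQF ε hε hg hq hq2
    hqN ha hodd h8q h18.le hM

end PeriodFree

end Summit.BirchSwinnertonDyer.Rank2

end
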